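import Literature.RepresentationTheory.MoeglinVignerasWaldspurger1987.RankOneThetaLiftRationalHyperbolicFrame
import Literature.NumberTheory.GelbartRogawski1991.UnitaryDualPairThetaKernelCM
import HarnessLib

/-!
# A rational «line ⊕ locally isotropic plane» frame, DIAGONAL form: `Pᵀ T P = diag(t, a₁, a₂)`

Topic `RepresentationTheory/MoeglinVignerasWaldspurger1987`; namespace
`Literature.RepresentationTheory.MoeglinVignerasWaldspurger1987.RationalHyperbolicFrame` (that of
`RankOneThetaLiftRationalHyperbolicFrame`).  KERNEL ONLY: theorems; no definition, no named fact, no `sorry`.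

★ `exists_rational_hyperbolic_frame` ([Omeara1963, §63C], [Jacobson1940HermitianForms, §3]) exports the rational frame as
`Pᵀ T P = t ⊕ᶠ T_H` with an ABSTRACT symmetric plane `T_H`, although its witnesses are `t = (t)` and `T_H = diag(a₁, a₂)` (the
orthogonal frame of ★ `exists_frame`).  The consumers of the cell `hodgecm-mathlib` (crux H413, programme P2, N3 road clause (a):
the CM local packages `chiLocalSplittingsCM L e₁ dV …` exist for DIAGONAL real frames `dV` only) need the diagonal form, so this file
re-runs the assembly of ★ `exists_rational_hyperbolic_frame` (same public ingredients ★ `exists_local_vector`, ★ `exists_rat_vector_mul_sq`,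
★ `exists_frame`, ★ `isIsotropic_standingData_diagonal`) keeping the diagonal witnesses:

* `exists_rational_hyperbolic_diagonal_frame` — `E/F` quadratic, `v` finite with `E ⊗ F_v` a field, `T ∈ Sym₃(F)` non-degenerate:
  there are `P ∈ GL₃(F)`, `t ∈ F^×`, `a : Fin 2 → F^×` with **`Pᵀ T P = diag(t, a₁, a₂)`** (`Matrix.diagonal (Fin.cons t a)`, also
  `= (t) ⊕ᶠ diag(a)`, `finSum_one_two_diagonal`) and the hermitian plane `diag(a₁, a₂) ⊗ 1` ISOTROPIC at `v`;
* `exists_rational_hyperbolic_realDiagonal_frame` — the CM instance: `L` a CM field, `dV : Fin 3 → L` real and non-zero, `v` a place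
  of `L⁺` NOT split in `L`: there are `P ∈ GL₃(L⁺)`, `t`, `a` as above with `Pᵀ · realDiagonal L dV · P = realDiagonal L dV′`,
  `dV′ = Fin.cons t a` read in `L`, and the plane `⟨a₁, a₂⟩` isotropic at `v` — the `(P, dV′)` over which the rational-frame
  naturality (★ `frameSection_localSplittingCMWith`), the block-adapted congruence and the local see-saw
  (★ `DoubledBlock.toRep_localSplittingCMWith_inlLoc_boxSB_of_eq`) are quantified.

HC_CM is NOT proved here and is proved only modulo the printed citations until rung 0 of the ladder closes.

## References
* [Omeara1963] O. T. O'Meara, *Introduction to Quadratic Forms* (1963), §42D, §63A Cor. 63:1b, §63C 63:17–63:19.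
* [Jacobson1940HermitianForms] N. Jacobson, Bull. AMS 46 (1940), §3 (1)(a).
-/

set_option autoImplicit false

noncomputable section

open scoped Matrix
open NumberField IsDedekindDomain
open Literature.NumberTheory.Automorphic Literature.NumberTheory.Automorphic.UnitaryGroup
open Literature.NumberTheory.Automorphic.Liu2021

namespace Literature.RepresentationTheory.MoeglinVignerasWaldspurger1987

namespace RationalHyperbolicFrame

/-! ## §1 Bookkeeping: `(t) ⊕ᶠ diag(a) = diag(t, a₁, a₂)`; the diagonal plane is hermitian and non-degenerate -/

section Bookkeeping

variable {K : Type*} [CommRing K]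

/-- `(t) ⊕ᶠ diag(a₁, a₂) = diag(t, a₁, a₂)` on `Fin 3 = Fin (1 + 2)`. [cite: Omeara1963, §42D] -/
theorem finSum_one_two_diagonal (t : K) (a : Fin 2 → K) :
    UnitaryGroup.finSum 1 2 (Matrix.diagonal fun _ : Fin 1 => t) (Matrix.diagonal a) =
      Matrix.diagonal (Fin.cons t a : Fin 3 → K) := by
  ext i j
  rw [UnitaryGroup.finSum, Matrix.reindex_apply, Matrix.submatrix_apply]
  fin_cases i <;> fin_cases j <;> rfl

variable (F E : Type) [Field F] [Field E] [Algebra F E] (c : E ≃ₐ[F] E)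

/-- the diagonal matrix `diag(a) ⊗ 1 ∈ M₂(E)` is `c`-hermitian. [cite: Jacobson1940HermitianForms, §3 (1)(a)] -/
theorem diagonal_map_hermitian' (a : Fin 2 → F) :
    (((Matrix.diagonal a).map (algebraMap F E)).map c)ᵀ = (Matrix.diagonal a).map (algebraMap F E) := by
  rw [Matrix.diagonal_map (map_zero _), Matrix.diagonal_map (map_zero _), Matrix.diagonal_transpose]
  congr 1
  funext k
  exact c.commutes (a k)

/-- the diagonal matrix `diag(a) ⊗ 1 ∈ M₂(E)` is non-degenerate when `a₁ a₂ ≠ 0`. [cite: Jacobson1940HermitianForms, §3 (1)(a)] -/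
theorem diagonal_map_det_ne_zero' (a : Fin 2 → F) (ha : ∀ k, a k ≠ 0) :
    ((Matrix.diagonal a).map (algebraMap F E)).det ≠ 0 := by
  rw [Matrix.diagonal_map (map_zero _), Matrix.det_diagonal]
  exact Finset.prod_ne_zero_iff.2 fun k _ => (map_ne_zero _).2 (ha k)

end Bookkeeping

/-! ## §2 The diagonal rational hyperbolic frame -/

section Assembly

variable (F E : Type) [Field F] [NumberField F] [Field E] [NumberField E] [Algebra F E]
  [Algebra.IsQuadraticExtension F E] (c : E ≃ₐ[F] E) {δ : E} (hcδ : c δ = -δ) (hδ : δ ≠ 0)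
  (v : HeightOneSpectrum (𝓞 F))

omit [NumberField F] [NumberField E] [Algebra.IsQuadraticExtension F E] in
/-- a ring homomorphism commutes with `b ↦ bᵀ T b`. [folklore] -/
private theorem map_dotProduct_mulVec' {R S : Type*} [CommRing R] [CommRing S] (f : R →+* S) {n : Type*} [Fintype n]
    (T : Matrix n n R) (b : n → R) : f (b ⬝ᵥ (T *ᵥ b)) = (f ∘ b) ⬝ᵥ (T.map f *ᵥ (f ∘ b)) := by
  rw [RingHom.map_dotProduct]
  congr 1
  funext i
  exact RingHom.map_mulVec f T b i

omit [NumberField F] [NumberField E] [Algebra.IsQuadraticExtension F E] in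
include hcδ hδ in
/-- `c ≠ 1` (it negates `δ ≠ 0`; characteristic zero). [folklore] -/
private theorem algEquiv_ne_one' [CharZero E] : c ≠ 1 := by
  rintro rfl
  exact hδ (CharZero.eq_neg_self_iff.1 (by simpa using hcδ))

/-- **A rational «line ⊕ locally isotropic plane» frame, DIAGONAL form.**  `E/F` quadratic with `c δ = -δ ≠ 0`, `v` a finite place
of `F` with `E_v = E ⊗_F F_v` a field, `T ∈ Sym₃(F)` non-degenerate.  Then there are `P ∈ GL₃(F)`, `t ∈ F`, `a : Fin 2 → F`, all
non-zero, with `Pᵀ T P = diag(t, a₁, a₂)` and the hermitian PLANE `(E_v², diag(a₁, a₂) ⊗ 1)` ISOTROPIC at `v` — the witnesses of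
★ `exists_rational_hyperbolic_frame`, exported diagonally. [cite: Omeara1963, §63C 63:17–63:19] [cite: Jacobson1940HermitianForms, §3 (1)(a)] -/
theorem exists_rational_hyperbolic_diagonal_frame (hE : IsField (LocalRing E v)) (T : Matrix (Fin 3) (Fin 3) F)
    (hT : T.IsSymm) (hTd : IsUnit T.det) :
    ∃ (P : GL (Fin 3) F) (t : F) (a : Fin 2 → F) (ha : ∀ k, a k ≠ 0), t ≠ 0 ∧
      (P : Matrix (Fin 3) (Fin 3) F)ᵀ * T * P = Matrix.diagonal (Fin.cons t a : Fin 3 → F) ∧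
        LemD1.IsIsotropic (LemD1OfPlace.standingData E v c 2 ((Matrix.diagonal a).map (algebraMap F E)) hcδ hδ (le_refl 2)
          (diagonal_map_hermitian' F E c a) (diagonal_map_det_ne_zero' F E a ha)) := by
  classical
  haveI : Invertible (2 : F) := invertibleOfNonzero two_ne_zero
  -- `δ² = d ∈ F`
  obtain ⟨d, hd⟩ := Literature.NumberTheory.QuadraticForms.QuadraticExtension.exists_algebraMap_eq_of_fixed
    (algEquiv_ne_one' F E c hcδ hδ) (x := δ * δ) (by rw [map_mul, hcδ]; ring)
  -- the local vector for `T_v`, `D = det T`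
  have hcoe : ∀ r : F, toLocalRing E v (algebraMap F (v.adicCompletion F) r) = algebraMap E (LocalRing E v) (algebraMap F E r) :=
    fun r => toLocalRing_coe E v r
  set Tv : Matrix (Fin 3) (Fin 3) (v.adicCompletion F) := T.map (algebraMap F (v.adicCompletion F)) with hTv
  have hTv_symm : Tv.IsSymm := hT.map _
  have hDv : algebraMap F (v.adicCompletion F) T.det ≠ 0 := (map_ne_zero _).2 hTd.ne_zero
  have hTv_det : Tv.det ≠ 0 := by
    have h : Tv.det = algebraMap F (v.adicCompletion F) T.det := by
      rw [hTv, RingHom.map_det, RingHom.mapMatrix_apply]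
    rw [h]
    exact hDv
  obtain ⟨x, p, q, hpq, hx⟩ := exists_local_vector F v Tv hTv_symm hTv_det
    (algebraMap F (v.adicCompletion F) T.det) (algebraMap F (v.adicCompletion F) d)
  -- the norm `N(p + q δ) = p² − d q² ≠ 0` (`E_v` a field)
  set z₀ : LocalRing E v := toLocalRing E v p + toLocalRing E v q * algebraMap E (LocalRing E v) δ with hz₀
  have hz₀0 : z₀ ≠ 0 := by
    intro h
    have h' : quadraticLocalMap E v δ (p, q) = quadraticLocalMap E v δ 0 := by
      rw [quadraticLocalMap_apply, map_zero]; exact h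
    have h'' := quadraticLocalMap_injective E v c hcδ hδ h'
    simp only [Prod.mk_eq_zero] at h''
    rcases hpq with hp | hq'
    · exact hp h''.1
    · exact hq' h''.2
  have hδv : algebraMap E (LocalRing E v) δ * algebraMap E (LocalRing E v) δ =
      toLocalRing E v (algebraMap F (v.adicCompletion F) d) := by
    rw [← map_mul, ← hd]
    exact (hcoe d).symm
  have hNz₀ : z₀ * conjLocal E c v z₀ = toLocalRing E v (p ^ 2 - algebraMap F _ d * q ^ 2) := by
    rw [hz₀, map_add, map_mul, conjLocal_toLocalRing, conjLocal_toLocalRing, conjLocal_algebraMap, hcδ, map_neg,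
      map_sub, map_pow, map_mul, map_pow, ← hδv]
    ring
  have hN0 : p ^ 2 - algebraMap F _ d * q ^ 2 ≠ 0 := by
    intro h0
    letI := hE.toField
    have h1 : z₀ * conjLocal E c v z₀ ≠ 0 :=
      mul_ne_zero hz₀0 (fun h => hz₀0 (by simpa using congrArg (conjLocal E c v) h))
    rw [hNz₀, h0, map_zero] at h1
    exact h1 rfl
  have hx0 : x ⬝ᵥ (Tv *ᵥ x) ≠ 0 := by
    rw [hx]
    exact mul_ne_zero (neg_ne_zero.2 hDv) hN0
  -- a rational `b` in the same square class of values
  obtain ⟨b, cc, hcc, hb⟩ := exists_rat_vector_mul_sq F v Tv x hx0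
  set t : F := b ⬝ᵥ (T *ᵥ b) with htdef
  have htv : algebraMap F (v.adicCompletion F) t = x ⬝ᵥ (Tv *ᵥ x) * cc ^ 2 := by
    rw [htdef, map_dotProduct_mulVec']
    exact hb
  have ht0 : t ≠ 0 := by
    intro h0
    rw [h0, map_zero] at htv
    exact mul_ne_zero hx0 (pow_ne_zero 2 hcc) htv.symm
  -- the rational orthogonal frame through `b`
  obtain ⟨P, a, hP, ha, heq⟩ := exists_frame T hT hTd.ne_zero b ht0
  have hdet : P.det * T.det * P.det = t * (a 0 * a 1) := by
    have h := congrArg Matrix.det heq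
    rw [Matrix.det_mul, Matrix.det_mul, Matrix.det_transpose, UnitaryGroup.finSum, Matrix.det_reindex_self,
      Matrix.det_fromBlocks_zero₂₁, Matrix.det_diagonal, Matrix.det_diagonal, Fin.prod_univ_one,
      Fin.prod_univ_two] at h
    rw [h]
  -- the isotropic vector, with `z = z₀ · ι cc`
  have hN : toLocalRing E v (algebraMap F _ t) =
      -toLocalRing E v (algebraMap F _ T.det) * ((z₀ * toLocalRing E v cc) * conjLocal E c v (z₀ * toLocalRing E v cc)) := by
    rw [htv, hx]
    simp only [map_mul, map_neg, map_pow, conjLocal_toLocalRing]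
    rw [← hNz₀]
    ring
  refine ⟨Matrix.GeneralLinearGroup.mkOfDetNeZero P hP, t, a, ha, ht0, ?_, ?_⟩
  · rw [← finSum_one_two_diagonal]
    exact heq
  · exact isIsotropic_standingData_diagonal F E c hcδ hδ v a ha t P.det T.det (mul_ne_zero ht0 hP)
      hdet.symm (z₀ * toLocalRing E v cc) hN

end Assembly

/-! ## §3 The CM instance: a real diagonal frame of a CM hermitian space -/

section CM

open Literature.NumberTheory.GelbartRogawski1991.UnitaryDualPair

variable (L : Type) [Field L] [NumberField L] [IsCMField L] (v : HeightOneSpectrum (𝓞 (maximalRealSubfield L)))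

/-- `Fin.cons t a` read in `L` is real (all its entries come from `L⁺`). [folklore] -/
private theorem complexConj_cons_algebraMap (t : ↥(maximalRealSubfield L)) (a : Fin 2 → ↥(maximalRealSubfield L)) (i : Fin 3) :
    IsCMField.complexConj L ((Fin.cons (algebraMap _ L t) (fun k => algebraMap _ L (a k)) : Fin 3 → L) i) =
      (Fin.cons (algebraMap _ L t) (fun k => algebraMap _ L (a k)) : Fin 3 → L) i := by
  refine Fin.cases ?_ (fun k => ?_) i
  · rw [Fin.cons_zero]; exact (IsCMField.complexConj L).commutes t
  · rw [Fin.cons_succ]; exact (IsCMField.complexConj L).commutes (a k)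

/-- `realDiagonal L (Fin.cons t a) _ = diag(t, a₁, a₂)` over `L⁺`. [folklore] -/
private theorem realDiagonal_cons (t : ↥(maximalRealSubfield L)) (a : Fin 2 → ↥(maximalRealSubfield L)) :
    realDiagonal L (Fin.cons (algebraMap _ L t) (fun k => algebraMap _ L (a k)) : Fin 3 → L)
        (complexConj_cons_algebraMap L t a) =
      Matrix.diagonal (Fin.cons t a : Fin 3 → ↥(maximalRealSubfield L)) := by
  rw [realDiagonal]
  congr 1
  funext i
  apply Subtype.ext
  refine Fin.cases ?_ (fun k => ?_) i
  · simp only [Fin.cons_zero]; rfl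
  · simp only [Fin.cons_succ]; rfl

/-- **The CM instance.**  `L` a CM field with maximal real subfield `L⁺`, `dV : Fin 3 → L` real and non-zero (the Gram data
`realDiagonal L dV` of a rank-3 CM hermitian space in an orthogonal basis), `v` a finite place of `L⁺` NOT split in `L`.  Then there are
a RATIONAL `P ∈ GL₃(L⁺)`, `t ∈ L⁺`, `a : Fin 2 → L⁺`, all non-zero, with `Pᵀ · diag(dV) · P = diag(t, a₁, a₂) = realDiagonal L dV′`,
`dV′ = Fin.cons t a` read in `L` (again a real non-zero diagonal frame), and the plane `(L_w², diag(a₁, a₂))` ISOTROPIC at `v`.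
[cite: Omeara1963, §63C 63:17–63:19] [cite: Jacobson1940HermitianForms, §3 (1)(a)] -/
theorem exists_rational_hyperbolic_realDiagonal_frame
    (hv : IsField (LocalRing L v)) (dV : Fin 3 → L) (hdV : ∀ i, IsCMField.complexConj L (dV i) = dV i) (hdV0 : ∀ i, dV i ≠ 0) :
    ∃ (P : GL (Fin 3) ↥(maximalRealSubfield L)) (t : ↥(maximalRealSubfield L)) (a : Fin 2 → ↥(maximalRealSubfield L))
      (ha : ∀ k, a k ≠ 0), t ≠ 0 ∧
      (P : Matrix (Fin 3) (Fin 3) ↥(maximalRealSubfield L))ᵀ * realDiagonal L dV hdV * P =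
          realDiagonal L (Fin.cons (algebraMap _ L t) (fun k => algebraMap _ L (a k)) : Fin 3 → L)
            (complexConj_cons_algebraMap L t a) ∧
        (∀ i, (Fin.cons (algebraMap _ L t) (fun k => algebraMap _ L (a k)) : Fin 3 → L) i ≠ 0) ∧
        LemD1.IsIsotropic (LemD1OfPlace.standingData L v (IsCMField.complexConj L) 2
          ((Matrix.diagonal a).map (algebraMap ↥(maximalRealSubfield L) L)) (complexConj_imagUnit L) (imagUnit_ne_zero L)
          (le_refl 2) (diagonal_map_hermitian' _ L (IsCMField.complexConj L) a) (diagonal_map_det_ne_zero' _ L a ha)) := by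
  obtain ⟨P, t, a, ha, ht0, heq, hiso⟩ := exists_rational_hyperbolic_diagonal_frame (maximalRealSubfield L) L
    (IsCMField.complexConj L) (complexConj_imagUnit L) (imagUnit_ne_zero L) v hv (realDiagonal L dV hdV)
    (realDiagonal_isSymm L dV hdV) (isUnit_det_realDiagonal L dV hdV hdV0)
  refine ⟨P, t, a, ha, ht0, ?_, fun i => ?_, hiso⟩
  · rw [heq, realDiagonal_cons]
  · refine Fin.cases ?_ (fun k => ?_) i
    · rw [Fin.cons_zero]; exact (map_ne_zero _).2 ht0
    · rw [Fin.cons_succ]; exact (map_ne_zero _).2 (ha k)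

end CM

end RationalHyperbolicFrame

end Literature.RepresentationTheory.MoeglinVignerasWaldspurger1987

end
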